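import Summits.Langlands.Langlands.Theorems.QuarterDeficit1951IcosahedralSupplyDoudMooreField
import Summits.Langlands.Langlands.Theorems.DedekindQuotient1951DoudMoorePermutationSupplyField
import Literature.NumberTheory.Automorphic.ArtinLFunctionsBrauerProofs
import HarnessLib

/-!
# Route `DedekindQuotient1951` (Langlands) — crux `QuinticDedekindPole` (stmt-Langlands-17270),
line `Sketch`: stub `stub_dmA5Datum`

**The Doud–Moore `A₅` datum, surjective.**  The five roots `θ i ∈ ℚ̄` of the totally real quintic
`f = x⁵ − x⁴ − 780x³ + 9911x² − 24208x + 15952` and a finite Galois quotient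
`q : Γ_ℚ → A₅ = alternatingGroup (Fin 5)` — surjective with open kernel (`IsArtinQuotient q`) —
through which `Γ_ℚ` permutes them: `σ • θ i = θ (q σ i)`.

Proof.  The landed stubs of route `QuarterDeficit1951` give the roots `θ i ∈ ℤ̄` and the
permutation representation `e₀ : Γ_ℚ → S₅` with open kernel (`stub_dmGaloisDatum`), triviality of
inertia away from `1951` (`stub_dmUnramified`), an inertia element of order `5` above `1951`
(`stub_dmLocal1951`) and evenness of the image together with an element of order `3`
(`stub_dmEvenOrderThree`).  So `e₀` factors through `A₅` (`MonoidHom.codRestrict`, same kernel),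
and its image is a subgroup of `S₅` containing elements of order `5` and `3`, hence contains `A₅`
(`alternatingGroup_le_of_orderOf`, landed in `…DoudMoorePermutationSupplyGroupTheory`: the even
part has order divisible by `15`, so index `≤ 4` in the simple group `A₅`, and a proper subgroup of
index `n ≤ 4` would embed `A₅` into `Sₙ`).  The four root clauses are transported along
`ℤ̄ ⊆ ℚ̄` (`integralClosure.coe_smul`).

References: D. Doud, M. W. Moore, *Even icosahedral Galois representations of prime conductor*,
J. Number Theory 118 (2006), §2 and §4 (Table, `p = 1951`) [`DoudMoore2006`]; B. Huppert,
*Endliche Gruppen I*, II.8 (subgroups of `A₅`).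
-/

set_option linter.dupNamespace false

noncomputable section

open scoped NumberField
open Field IsDedekindDomain
open Literature.NumberTheory.Automorphic Literature.NumberTheory.GaloisRepresentations

namespace Summit.Langlands.Langlands.Theorems.DedekindQuotient1951

/-- **Surjectivity onto `A₅`.**  A homomorphism `e₀ : Γ → S₅` with even image containing an
element of order `5` and an element of order `3` maps onto `A₅`: its range contains `A₅`
(`alternatingGroup_le_of_orderOf`). [folklore] -/
theorem surjective_codRestrict_alternatingGroup_of_orderOf {Γ : Type*} [Group Γ]
    (e₀ : Γ →* Equiv.Perm (Fin 5)) (hmem : ∀ σ, e₀ σ ∈ alternatingGroup (Fin 5))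
    (h5 : ∃ σ, orderOf (e₀ σ) = 5) (h3 : ∃ σ, orderOf (e₀ σ) = 3) :
    Function.Surjective (e₀.codRestrict (alternatingGroup (Fin 5)) hmem) := by
  obtain ⟨σ₅, h₅⟩ := h5
  obtain ⟨σ₃, h₃⟩ := h3
  have hle : alternatingGroup (Fin 5) ≤ e₀.range :=
    alternatingGroup_le_of_orderOf ⟨σ₅, rfl⟩ ⟨σ₃, rfl⟩ h₅ h₃
  intro a
  obtain ⟨σ, hσ⟩ := hle a.2
  exact ⟨σ, Subtype.ext hσ⟩

/-- **Stub `stub_dmA5Datum` (the Doud–Moore `A₅` datum, SURJECTIVE).**  The five roots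
`θ i ∈ ℚ̄` of the quintic `x⁵ − x⁴ − 780x³ + 9911x² − 24208x + 15952` and a finite Galois quotient
`q : Γ_ℚ → A₅` (surjective with open kernel) through which `Γ_ℚ` permutes them
(`σ • θ i = θ (q σ i)`).  From the landed `stub_dmGaloisDatum` (`e₀ : Γ_ℚ → S₅` on the roots, open
kernel), `stub_dmLocal1951` (an inertia element of order `5` above `1951`) and
`stub_dmEvenOrderThree` (even image with an element of order `3`): a subgroup of `A₅` of order
divisible by `15` is `A₅`. [cite: DoudMoore2006, §2 and §4] -/
theorem stub_dmA5Datum :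
    ∃ (θ : Fin 5 → AlgebraicClosure ℚ) (q : Field.absoluteGaloisGroup ℚ →* alternatingGroup (Fin 5)),
      IsArtinQuotient q ∧
      (∀ i, θ i ^ 5 - θ i ^ 4 - 780 * θ i ^ 3 + 9911 * θ i ^ 2 - 24208 * θ i + 15952 = 0) ∧
      Function.Injective θ ∧
      (∀ x : AlgebraicClosure ℚ, x ^ 5 - x ^ 4 - 780 * x ^ 3 + 9911 * x ^ 2 - 24208 * x + 15952 = 0 →
        ∃ i, x = θ i) ∧
      (∀ (σ : Field.absoluteGaloisGroup ℚ) (i : Fin 5), σ • θ i = θ ((q σ : Equiv.Perm (Fin 5)) i)) := by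
  classical
  obtain ⟨θ, e₀, hroot, hinj, hall, he₀, hopen, -⟩ := QuarterDeficit1951.stub_dmGaloisDatum
  have hunr := QuarterDeficit1951.stub_dmUnramified θ hroot hinj hall
  have hloc := QuarterDeficit1951.stub_dmLocal1951 θ hroot hinj hall e₀ he₀
  obtain ⟨hsign, σ₃, hσ₃1, hσ₃⟩ :=
    QuarterDeficit1951.stub_dmEvenOrderThree θ hroot hinj hall e₀ he₀ hopen hunr hloc
  -- `e₀` lands in `A₅`
  have hmem : ∀ σ, e₀ σ ∈ alternatingGroup (Fin 5) := fun σ =>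
    Equiv.Perm.mem_alternatingGroup.mpr (hsign σ)
  -- an element of order `3` in the image
  have h3 : ∃ σ, orderOf (e₀ σ) = 3 := by
    haveI : Fact (Nat.Prime 3) := ⟨by norm_num⟩
    exact ⟨σ₃, orderOf_eq_prime hσ₃ hσ₃1⟩
  -- an element of order `5` in the image: a generator of the inertia above `(1951)`
  have h5 : ∃ σ, orderOf (e₀ σ) = 5 := by
    have hp : Nat.Prime 1951 := by norm_num
    set v₀ : HeightOneSpectrum (𝓞 ℚ) :=
      (Rat.HeightOneSpectrum.primesEquiv (R := 𝓞 ℚ)).symm ⟨1951, hp⟩ with hv₀def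
    have hv₀ : ((1951 : ℕ) : 𝓞 ℚ) ∈ v₀.asIdeal :=
      (Literature.NumberTheory.EllipticCurves.natCast_mem_asIdeal_iff_eq_primesEquiv_symm v₀
        hp).mpr rfl
    have hv₀res : v₀.residueCard = 1951 := Rat.residueCard_eq_of_natCast_mem hp hv₀
    obtain ⟨𝔓₀, h𝔓₀⟩ := HeightOneSpectrum.primesAbove_nonempty v₀
    obtain ⟨g₅, hg₅, hI₅, -⟩ := hloc v₀ hv₀res 𝔓₀ h𝔓₀
    obtain ⟨σ₅, -, hσ₅⟩ := exists_apply_eq_of_map_eq_zpowers e₀ _ g₅ hI₅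
    exact ⟨σ₅, by rw [hσ₅, hg₅]⟩
  refine ⟨fun i => (θ i : AlgebraicClosure ℚ), e₀.codRestrict (alternatingGroup (Fin 5)) hmem,
    ⟨surjective_codRestrict_alternatingGroup_of_orderOf e₀ hmem h5 h3,
      by rw [MonoidHom.ker_codRestrict]; exact hopen⟩,
    fun i => ?_, Subtype.val_injective.comp hinj, fun x hx => hall x hx,
    fun σ i => dm_smul_coe he₀ σ i⟩
  -- the root relation, pushed along `ℤ̄ ⊆ ℚ̄`
  have h := congrArg (Subtype.val : absIntegers (𝓞 ℚ) ℚ → AlgebraicClosure ℚ) (hroot i)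
  rw [ZeroMemClass.coe_zero] at h
  push_cast at h
  exact h

end Summit.Langlands.Langlands.Theorems.DedekindQuotient1951

end
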